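import Summits.ResolutionOfSingularities.ResolutionOfSingularities.Theorems.EquisingularLiftEquisingularLiftNatOneStep
import Summits.ResolutionOfSingularities.ResolutionOfSingularities.Theorems.EquisingularLiftEquisingularLiftLinearCentreLift
import Summits.ResolutionOfSingularities.ResolutionOfSingularities.Theorems.EquisingularLiftEquisingularLiftLinearCentreCharts
import Summits.ResolutionOfSingularities.ResolutionOfSingularities.Theorems.EquisingularLiftEquisingularLiftGoodAtOfSmooth
import Summits.ResolutionOfSingularities.ResolutionOfSingularities.Theorems.EquisingularLiftEquisingularLiftWittRing
import Literature.AlgebraicGeometry.FundamentalGroup.HyperplanePencil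
import HarnessLib

/-!
# [OURS · L1 W4.5(b)] THE LINEAR-CENTRE RUNG FOR EL♮: one blow-up along a coordinate `ℙʳ ⊂ ℙʳ⁺ᵐ` lying on `H` that resolves `H`
# (crux `Theses.EquisingularLift.EquisingularLiftNat`, stmt-ResolutionOfSingularities-20038; any `r, m`)

NOT a statement of any manuscript; OURS kernel theorem (cell `res-hironaka`, chain w45b; seat res-D-pv-013, own initiative, counted 0). AI-written,
weaker than expert review. No definition, no `sorry`, standard axioms.

**`elNatAt_of_linearCentre`.** Let `K` be algebraically closed of characteristic `p`, `H` integral, `ι : H ↪ ℙʳ⁺ᵐ_K` a closed immersion, and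
`f_K : K[x₀,…,x_{r+m}] ↠ K[x₀,…,x_r]` the graded surjection killing the last `m` variables, `Λ = ker Proj(f_K)` the ideal sheaf of the coordinate
linear subspace `L = V₊(x_{r+1},…,x_{r+m}) ≅ ℙʳ`. If `L ⊆ ι(H)`, `ι(H) ⊄ L`, and EVERY blow-up of `H` along `Λ·𝒪_H` is a regular scheme, then
`Theorems.EquisingularLift.ELNatAt p K (r + m) H ι`.

Witnesses: `O = 𝕎(K)` (`stub_wittRing`), ONE horizontal step of `elNatAt_of_oneStep₀` (p505461) with centre `C = ker Proj(f_O) ≅ ℙʳ_O` — regular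
(`stub_goodAtOfSmooth` on the smooth proper `ℙʳ_O`, transported along `Proj(f_O) ≅ image`) and `O`-flat (`projMap_kill_comp_structureMap`:
`C → Spec O` IS the structure map of `ℙʳ_O`) — whose special fibre is `Λ` (`comap_ker_projMap_kill`, any coefficient surjection `φ = map π`).
This is the upstairs half of `FermatCone.elNatAt_fermatCone` (p518711, `(r,m) = (0,3)`) and `Cone.elNatAt_cone` (p524856) made generic in
`(r, m)`: those theorems are this rung plus their downstairs chart analysis (`isRegular_of_isBlowup_comap`).

Consumers: cones over smooth hypersurfaces with vertex a coordinate `ℙʳ` (one blow-up of the vertex resolves), surfaces with a coordinate double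
LINE resolved by one blow-up (`(r,m) = (1,2)`), in every ambient dimension.
-/

set_option linter.dupNamespace false -- mandated namespace `Summit.<Summit>.<Problem>` of this single-conjunct summit

noncomputable section

open CategoryTheory CategoryTheory.Limits AlgebraicGeometry TopologicalSpace
open MvPolynomial HomogeneousLocalization
open Literature.AlgebraicGeometry.Resolution
open Literature.AlgebraicGeometry.Motives
open AlgebraicGeometry.Scheme.IdealSheafData
open Summit.ResolutionOfSingularities.ResolutionOfSingularities.Cruxes.EquisingularLift.StrataSplit

namespace Summit.ResolutionOfSingularities.ResolutionOfSingularities.Cruxes.EquisingularLiftNat.Sections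

attribute [local instance] MvPolynomial.gradedAlgebra ProjBaseChange.algebraBase in
/-- **THE LINEAR-CENTRE RUNG FOR EL♮** (any `r, m`): `H ⊆ ℙʳ⁺ᵐ_K` integral, `Λ = ker Proj(f_K)` the ideal sheaf of the coordinate `ℙʳ`
killed by `f_K`; if `supp Λ ⊆ ι(H)`, `ι(H) ⊄ supp Λ` and every blow-up of `H` along `Λ·𝒪_H` is regular, then `ELNatAt p K (r + m) H ι` — one
horizontal E1 step over `𝕎(K)` with centre `ker Proj(f_O) ≅ ℙʳ_O` (`elNatAt_of_oneStep₀`). [OURS · L1 W4.5b] [folklore] -/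
theorem elNatAt_of_linearCentre (p : ℕ) (hp : p.Prime) (K : Type) [Field K] [CharP K p] [IsAlgClosed K] (r m : ℕ)
    (H : Scheme.{0}) (ι : H ⟶ (projectiveSpace (r + m) K).left) [IsClosedImmersion ι] [IsIntegral H]
    (fk : homogeneousSubmodule (Fin (r + m + 1)) K →+*ᵍ homogeneousSubmodule (Fin (r + 1)) K)
    (hfk' : HomogeneousIdeal.irrelevant (homogeneousSubmodule (Fin (r + 1)) K) ≤
      (HomogeneousIdeal.irrelevant (homogeneousSubmodule (Fin (r + m + 1)) K)).map fk)
    (hfkC : ∀ a : K, fk (C a) = C a)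
    (hfkX : ∀ i : Fin (r + m + 1), fk (X i) = if h : (i : ℕ) < r + 1 then X ⟨i, h⟩ else 0)
    (hsupp : ((Proj.map fk hfk').ker.support : Set (Proj (homogeneousSubmodule (Fin (r + m + 1)) K))) ⊆ Set.range ι)
    (hgen : ¬ (Set.range ι ⊆ ((Proj.map fk hfk').ker.support : Set (Proj (homogeneousSubmodule (Fin (r + m + 1)) K)))))
    (hdown : ∀ (Z : Scheme.{0}) (ρ : Z ⟶ H), IsBlowup ρ ((Proj.map fk hfk').ker.comap ι) → Scheme.IsRegular Z) :
    Theorems.EquisingularLift.ELNatAt p K (r + m) H ι := by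
  classical
  obtain ⟨O, i1, i2, i3, i4, -, -, π, hπ⟩ := stub_wittRing p hp K
  obtain ⟨fO, hfO', hfOC, hfOX⟩ := EquisingularLift.StrataSplit.LinearCentre.exists_kill O r m
  -- the centre `C = ker Proj(f_O) ≅ ℙʳ_O`: regular and `O`-flat
  obtain ⟨hsmr, -⟩ := stub_projectiveAmbientSmoothProper O r
  set iO : Proj (homogeneousSubmodule (Fin (r + 1)) O) ⟶ Proj (homogeneousSubmodule (Fin (r + m + 1)) O) :=
    Proj.map fO hfO' with hiOdef
  haveI : IsClosedImmersion iO :=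
    Literature.AlgebraicGeometry.FundamentalGroup.isClosedImmersion_projMap_of_surjective fO hfO'
      (EquisingularLift.StrataSplit.LinearCentre.kill_surjective (r := r) (m := m) fO.toRingHom (fun a => hfOC a) (fun i => hfOX i))
  have hRr : Scheme.IsRegular (Proj (homogeneousSubmodule (Fin (r + 1)) O)) := fun y =>
    (stub_goodAtOfSmooth O _ _ hsmr y).1
  have hCreg : Scheme.IsRegular iO.ker.subscheme := hRr.of_iso iO.toImage
  have hCflat : Flat (iO.ker.subschemeι ≫ Proj.toSpecZero (homogeneousSubmodule (Fin (r + m + 1)) O) ≫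
      Spec.map (CommRingCat.ofHom (algebraMap O (homogeneousSubmodule (Fin (r + m + 1)) O 0)))) := by
    have h1 : iO.toImage ≫ iO.ker.subschemeι ≫ (Proj.toSpecZero (homogeneousSubmodule (Fin (r + m + 1)) O) ≫
        Spec.map (CommRingCat.ofHom (algebraMap O (homogeneousSubmodule (Fin (r + m + 1)) O 0)))) =
        Proj.toSpecZero (homogeneousSubmodule (Fin (r + 1)) O) ≫
          Spec.map (CommRingCat.ofHom (algebraMap O (homogeneousSubmodule (Fin (r + 1)) O 0))) := by
      rw [← Category.assoc]
      change (iO.toImage ≫ iO.imageι) ≫ _ = _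
      rw [Scheme.Hom.toImage_imageι]
      exact EquisingularLift.StrataSplit.LinearCentre.projMap_kill_comp_structureMap (r := r) (m := m) fO hfO' hfOC hfOX
    haveI := hsmr
    have h2 : Flat (iO.toImage ≫ iO.ker.subschemeι ≫ (Proj.toSpecZero (homogeneousSubmodule (Fin (r + m + 1)) O) ≫
        Spec.map (CommRingCat.ofHom (algebraMap O (homogeneousSubmodule (Fin (r + m + 1)) O 0))))) := by
      rw [h1]; infer_instance
    exact (MorphismProperty.cancel_left_of_respectsIso @Flat iO.toImage _).mp h2
  refine elNatAt_of_oneStep₀ K (r + m) H ι O π hπ iO.ker hCreg hCflat (Proj.map fk hfk').ker ?_ hgen hsupp hdown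
  intro φ hφ' hφ
  exact EquisingularLift.StrataSplit.LinearCentre.comap_ker_projMap_kill (r := r) (m := m) π hπ φ hφ hφ' fO hfO' hfOC hfOX fk hfk' hfkC hfkX

end Summit.ResolutionOfSingularities.ResolutionOfSingularities.Cruxes.EquisingularLiftNat.Sections

end
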